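import Summits.BirchSwinnertonDyer.Rank1Residual.X11b.HalvesReceptacle
import Summits.BirchSwinnertonDyer.Rank1Residual.X11b.AnticyclotomicSelmerDual
import Summits.BirchSwinnertonDyer.BirchSwinnertonDyer.Theorems.ErratumRoadFiveSigmaEulerFactorBinomialModP
import Literature.NumberTheory.EllipticCurves.IwasawaAlgebra
import HarnessLib

/-!
# Route `CumulativeHeegnerLeopoldt`, crux K1 `CumulativeHeegnerInclusionAtThree` (stmt-BirchSwinnertonDyer-24198), line
# `birth`, STUB B `stub_charPrincipalMuZero`: ITS PRINCIPAL HALF IS FREE — `Ch_Λ(X)·R₀⟦T⟧` is always principal, and a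
# `Λ`-generator with a unit coefficient (`μ = 0`) maps to an `R₀⟦T⟧`-generator with a norm-one coefficient

Route-independent algebra (no `Theses` import; cell `bsd-wall`, lead prover seat `bsd-line-chl-p1` g5, 2026-08-28,
`--supports stmt-BirchSwinnertonDyer-24198 --as helper`). STUB B of line `birth` asks, at a frame, for
`∃ g n, (XAc.charIdeal E 3 κ 𝔭′ ∅ γ).map (PowerSeries.map (toUnr 3)) = (g) ∧ ‖g_n‖ = 1`. Two bookkeeping facts
isolate its content:

* `exists_map_charIdeal_eq_span` — for EVERY `Λ = ℤ_p⟦T⟧`-module `M`, `Ch_Λ(M)·R₀⟦T⟧ := (Ch_Λ M).map (map toUnr)` is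
  principal: `Ch_Λ(M)` is principal (`charIdeal_isPrincipal_holds`: `Λ` is a UFD, tree theorem) and the image of a
  principal ideal under a ring map is generated by the image of the generator (`Ideal.map_span`; the same four lines as
  SOED's `…LeverCurrency.charIdeal_map_eq_span`, not imported so as to stay out of that route's cone). So the `∃ g` of
  STUB B carries no content;
* `exists_map_charIdeal_eq_span_norm_eq_one_of_isUnit_coeff` — if `Ch_Λ(M) = (f)` with `f` having SOME unit
  coefficient in `ℤ_p` (i.e. `p ∤ f`, `μ(f) = 0`), then `g := f` read in `R₀⟦T⟧` generates `Ch_Λ(M)·R₀⟦T⟧` and has a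
  coefficient of norm `1` (`‖toUnr x‖ = ‖x‖`, tree lemma `SigmaFactorFU.norm_coeff_map_toUnr`). So STUB B ⟸ "`μ_alg = 0` in `Λ`" — the statement K2's algebraic half
  (Rubin's two-variable main conjecture + the character comparison on the non-anomalous cell) would deliver, in
  its own currency `Λ`, before any base change to `R₀`.

The `XAc` specialisations (`XAc.charIdeal` is `Module.charIdeal` by definition) are the forms the line consumes. No
elliptic-curve arithmetic enters; nothing here proves `μ = 0`. No definition, no named fact, no `sorry`.

References: [Washington1997] §13.2 (structure of `Λ`, `μ`-invariant, `Λ` a UFD); [Castella2018] §2.2–§3 (the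
receptacle `R₀⟦T⟧`, `1 + T ↦ γ`).
-/

noncomputable section

open scoped Classical

set_option linter.dupNamespace false
set_option autoImplicit false

namespace Summit.BirchSwinnertonDyer.BirchSwinnertonDyer.Theorems.CumulativeHeegnerInclusionAtThreeMuTransfer

open PowerSeries Literature.NumberTheory.EllipticCurves
  Summit.BirchSwinnertonDyer.Rank1Residual.X11b

universe u

variable {p : ℕ} [Fact p.Prime]

/-- A unit coefficient of `f ∈ Λ` is read in `R₀⟦T⟧` as a coefficient of norm `1` (`ℤ_p → R₀ ⊂ ℂ_p` is
isometric: `SigmaFactorFU.norm_coeff_map_toUnr`, cited). [folklore] -/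
theorem norm_coeff_map_toUnr_eq_one_of_isUnit (f : IwasawaAlgebra p) {n : ℕ}
    (hn : IsUnit (PowerSeries.coeff n f)) :
    ‖((PowerSeries.coeff n (PowerSeries.map (Halves.toUnr p) f) : unrIntegers p) : ℂ_[p])‖ = 1 := by
  rw [SigmaFactorFU.norm_coeff_map_toUnr]
  exact PadicInt.isUnit_iff.mp hn

/-- The image in `R₀⟦T⟧` of a principal ideal `(f) ⊆ Λ` is the principal ideal generated by `f` read in
`R₀⟦T⟧`. [folklore] -/
theorem map_span_singleton_toUnr (f : IwasawaAlgebra p) :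
    (Ideal.span {f}).map (PowerSeries.map (Halves.toUnr p)) =
      Ideal.span {PowerSeries.map (Halves.toUnr p) f} := by
  rw [Ideal.map_span, Set.image_singleton]

/-- **`Ch_Λ(M)·R₀⟦T⟧` is principal for every `Λ`-module `M`** (`Λ = ℤ_p⟦T⟧` is a UFD, so `Ch_Λ(M)` is
principal — tree theorem `charIdeal_isPrincipal_holds`, junk cases included — and `Ideal.map` of a principal
ideal is principal). [cite: Washington1997, §13.2] -/
theorem exists_map_charIdeal_eq_span (M : Type u) [AddCommGroup M] [Module (IwasawaAlgebra p) M] :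
    ∃ g : UnrSeries p, (Module.charIdeal (IwasawaAlgebra p) M).map (PowerSeries.map (Halves.toUnr p)) =
      Ideal.span {g} := by
  obtain ⟨f, hf⟩ := (charIdeal_isPrincipal_holds p M).principal
  refine ⟨PowerSeries.map (Halves.toUnr p) f, ?_⟩
  rw [hf, Ideal.submodule_span_eq, map_span_singleton_toUnr]

/-- **`μ = 0` in `Λ` transfers to a norm-one coefficient in `R₀⟦T⟧`.** If `Ch_Λ(M) = (f)` and the `n`-th
coefficient of `f` is a unit of `ℤ_p`, then `g := f` read in `R₀⟦T⟧` generates `Ch_Λ(M)·R₀⟦T⟧` and `‖g_n‖ = 1`.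
[cite: Washington1997, §13.2] -/
theorem exists_map_charIdeal_eq_span_norm_eq_one_of_isUnit_coeff (M : Type u) [AddCommGroup M]
    [Module (IwasawaAlgebra p) M] {f : IwasawaAlgebra p}
    (hf : Module.charIdeal (IwasawaAlgebra p) M = Ideal.span {f}) {n : ℕ}
    (hn : IsUnit (PowerSeries.coeff n f)) :
    ∃ g : UnrSeries p, (Module.charIdeal (IwasawaAlgebra p) M).map (PowerSeries.map (Halves.toUnr p)) =
      Ideal.span {g} ∧ ‖((PowerSeries.coeff n g : unrIntegers p) : ℂ_[p])‖ = 1 := by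
  refine ⟨PowerSeries.map (Halves.toUnr p) f, ?_, ?_⟩
  · rw [hf, map_span_singleton_toUnr]
  · exact norm_coeff_map_toUnr_eq_one_of_isUnit f hn

/-! ## The forms consumed at a frame of K1/K2 (`X = XAc E p κ 𝔭′ S γ`, `XAc.charIdeal = Module.charIdeal`) -/

variable {K : Type u} [Field K] [NumberField K] (E : WeierstrassCurve K) (p)
  (κ : ZpExtension K p) (𝔭 : IsDedekindDomain.HeightOneSpectrum (NumberField.RingOfIntegers K))
  (S : Set (IsDedekindDomain.HeightOneSpectrum (NumberField.RingOfIntegers K)))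
  (γ : Field.absoluteGaloisGroup K) [Fact (κ.IsTopGenerator γ)]

/-- **The principal half of STUB B is free**: `(Ch_Λ X_ac^Σ)·R₀⟦T⟧` is principal at every datum.
[cite: Castella2018, Thm. 2.3 (arXiv:1704.06608 p. 5), "a generator of `Ch_Λ(X_ac^Σ(E[p^∞]))`"] -/
theorem exists_map_XAcCharIdeal_eq_span :
    ∃ g : UnrSeries p, (AcSelmer.XAc.charIdeal E p κ 𝔭 S γ).map (PowerSeries.map (Halves.toUnr p)) =
      Ideal.span {g} :=
  exists_map_charIdeal_eq_span (AcSelmer.XAc E p κ 𝔭 S γ)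

/-- **STUB B ⟸ `μ_alg = 0` in `Λ`**: if `Ch_Λ(X_ac^Σ) = (f)` with `f` having a unit coefficient, then STUB B's
conclusion holds at this datum with `g := f` read in `R₀⟦T⟧`. [cite: Washington1997, §13.2]
[cite: Castella2018, Thm. 2.3 (arXiv:1704.06608 p. 5)] -/
theorem exists_map_XAcCharIdeal_eq_span_norm_eq_one_of_isUnit_coeff {f : IwasawaAlgebra p}
    (hf : AcSelmer.XAc.charIdeal E p κ 𝔭 S γ = Ideal.span {f}) {n : ℕ} (hn : IsUnit (PowerSeries.coeff n f)) :
    ∃ (g : UnrSeries p) (m : ℕ), (AcSelmer.XAc.charIdeal E p κ 𝔭 S γ).map (PowerSeries.map (Halves.toUnr p)) =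
      Ideal.span {g} ∧ ‖((PowerSeries.coeff m g : unrIntegers p) : ℂ_[p])‖ = 1 := by
  obtain ⟨g, hg, hgn⟩ :=
    exists_map_charIdeal_eq_span_norm_eq_one_of_isUnit_coeff (AcSelmer.XAc E p κ 𝔭 S γ) hf hn
  exact ⟨g, n, hg, hgn⟩

end Summit.BirchSwinnertonDyer.BirchSwinnertonDyer.Theorems.CumulativeHeegnerInclusionAtThreeMuTransfer

end
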